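import Mathlib
import Literature.Probability.LatticeModels.GKSInequalities

/-!
# Sketch — first lemmas for the crux-idea cards on `InverseMFerromagnet` (stmt-CriticalPhenomena-4798)

Card `two-hub-schur-reduction`:
* `LeafSmoothing`      — the elementary inequality E_m to which IM on K_{2,m} (+ hub edge) reduces
                          after conditioning on the hub pair and a Woodbury step (proved on paper in
                          the card by a concave/convex smoothing argument; equality iff ≤ 2 leaves).
* `InverseMTwoHub`     — IM for every zero-field pair ferromagnet all of whose edges touch one of two
                          hubs (K_{2,m} with multi-edges, pendant leaves and the hub edge): the first
                          3-connected family beyond LUZ's cycles.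
Card `conditioned-griffiths-ladder`:
* `TruncatedPathInequality` — rung 1 of the ladder: Griffiths' path inequality for TRUNCATED
                          two-point functions in nonnegative field (pair couplings + fields ≥ 0).
* `ladder_step`        — the linear-algebra step: a path inequality for the partial-covariance
                          kernel given α lifts nonnegativity from |α| to |α|+1 (stated over matrices).
-/

namespace Summit.CriticalPhenomena.Ising3DConformalLimit.Cruxes.InverseMFerromagnet.Sketch

open scoped BigOperators
open Literature.Probability.LatticeModels

/-- E_m' (leaf smoothing): for `ρᵢ ∈ (0,1]` and `0 < r ≤ ∏ ρᵢ`,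
`∑ᵢ 1/(r + ρᵢ²) ≤ (1 + (m-1) r)/(r (1+r))`, with equality when `r = ∏ρᵢ` and at most two `ρᵢ < 1`. -/
def LeafSmoothing : Prop :=
  ∀ (m : ℕ) (ρ : Fin m → ℝ) (r : ℝ), (∀ i, 0 < ρ i ∧ ρ i ≤ 1) → 0 < r → r ≤ ∏ i, ρ i →
    (∑ i, 1 / (r + ρ i ^ 2)) ≤ (1 + ((m : ℝ) - 1) * r) / (r * (1 + r))

/-- IM for two-hub graphs: every coupling pair contains hub `0` or hub `1`
(K_{2,m} with multi-edges, pendant leaves and the hub edge allowed). Same shape as the crux. -/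
def InverseMTwoHub : Prop :=
  ∀ (n m : ℕ) (K : Fin m → ℝ) (C : Fin m → Finset (Fin (n + 2))), (∀ i, 0 ≤ K i) →
    (∀ i, (C i).card = 2) → (∀ i, (0 : Fin (n + 2)) ∈ C i ∨ (1 : Fin (n + 2)) ∈ C i) →
    ∀ x y : Fin (n + 2), x ≠ y →
      (Matrix.of fun (p q : Fin (n + 2)) =>
          gksExpect Finset.univ K C (fun ω => spinAt p ω * spinAt q ω))⁻¹ x y ≤ 0

/-- Rung 1 of the conditioned Griffiths ladder (TP): for pair couplings and fields `Kᵢ ≥ 0`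
(`|Cᵢ| ≤ 2`), the truncated two-point function `χ(u,v) = ⟨σ_uσ_v⟩ - ⟨σ_u⟩⟨σ_v⟩` satisfies
Griffiths' path inequality `χ(x,y) χ(z,z) ≥ χ(x,z) χ(z,y)`. At zero field this is GKS II. -/
def TruncatedPathInequality : Prop :=
  ∀ (n m : ℕ) (K : Fin m → ℝ) (C : Fin m → Finset (Fin n)), (∀ i, 0 ≤ K i) →
    (∀ i, (C i).card ≤ 2) → ∀ x y z : Fin n,
      let χ : Fin n → Fin n → ℝ := fun u v =>
        gksExpect Finset.univ K C (fun ω => spinAt u ω * spinAt v ω) -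
          gksExpect Finset.univ K C (spinAt u) * gksExpect Finset.univ K C (spinAt v)
      χ x z * χ z y ≤ χ x y * χ z z

/-- The zero-field form of rung 1 (conditioning spin `a` made explicit): a 4-site inequality among
two-point functions of an arbitrary zero-field pair ferromagnet. Implied by the crux (Schur
complements of inverse M-matrices are inverse M); rung `k = 1` of a ladder equivalent to it. -/
def PathAfterOneConditioning : Prop :=
  ∀ (n m : ℕ) (K : Fin m → ℝ) (C : Fin m → Finset (Fin n)), (∀ i, 0 ≤ K i) →
    (∀ i, (C i).card = 2) → ∀ x y z a : Fin n, a ≠ x → a ≠ y → a ≠ z →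
      let S : Fin n → Fin n → ℝ := fun u v =>
        gksExpect Finset.univ K C (fun ω => spinAt u ω * spinAt v ω)
      (S x z - S x a * S a z) * (S z y - S z a * S a y) ≤
        (S x y - S x a * S a y) * (S z z - S z a * S a z)

/-- Ladder step (pure linear algebra, stated for real symmetric matrices): if the Schur complement
of a positive-definite matrix with nonnegative entries onto a coordinate set has nonnegative
entries and satisfies the path inequality at a pivot `s`, then eliminating `s` keeps the entries
nonnegative. This is the mechanism by which `PATH_k ⇒ (IM_k ⇒ IM_{k+1})`. -/
theorem ladder_step {ι : Type*} [Fintype ι] [DecidableEq ι] (Kα : Matrix ι ι ℝ)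
    (hnonneg : ∀ u v, 0 ≤ Kα u v) (s : ι) (hs : 0 < Kα s s)
    (hpath : ∀ u v, Kα u s * Kα s v ≤ Kα u v * Kα s s) (u v : ι) :
    0 ≤ Kα u v - Kα u s * Kα s v / Kα s s := by
  have h := hpath u v
  rw [sub_nonneg, div_le_iff₀ hs]
  linarith

end Summit.CriticalPhenomena.Ising3DConformalLimit.Cruxes.InverseMFerromagnet.Sketch
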